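import Mathlib
import HarnessLib
import Summits.HodgeConjecture.HodgeConjecture.Theses.KleimanBFSeeds
import Literature.AlgebraicGeometry.HodgeTheory.ChernCharacterBetti
import Literature.AlgebraicGeometry.HodgeTheory.ChernCharacterBettiSums
import Literature.AlgebraicGeometry.HodgeTheory.KleimanChernNormalForm
import Literature.AlgebraicGeometry.HodgeTheory.TwistNormalisedChernCharacter
import Literature.AlgebraicGeometry.KTheory.ChernCharacterPresentsAlgebraicClasses
import Literature.AlgebraicGeometry.KTheory.GrothendieckGroup

/-!
# Stub `stub_virtualComplements` of the birth skeleton of crux `KleimanChernCharacterOnBetti`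
(stmt-HodgeConjecture-26526, route `KleimanBFSeeds`) MODULO the shared construction item and Fulton's fact

HONEST FRAMING: a CONDITIONAL helper (`--supports stmt-HodgeConjecture-26526`). It constructs NO Chern character
on Betti cohomology; the registered stub `stub_virtualComplements : ∃ C, SumVirtualNormalForm C ∧
HTrivialComplements C` (skeleton `Cruxes/KleimanChernCharacterOnBetti/Lines/birth.lean`) stays OPEN, and nothing
here proves K-C⁺, K2, rung H2, HC_AV, HC_CM or HC. What is proved, for EVERY hypothesis structure
`C : ChernCharacterBetti`, from the Literature NAMED FACT `KTheory.Fulton1998_chernCharacter_presentsAlgebraicClasses`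
(vector bundles present rational algebraic classes up to a positive multiple, modulo powers of the hyperplane
class; an unproved `def … : Prop`):

* (SVNF) `sumVirtualNormalForm_of_presentsAlgebraicClasses` — the sum-normalised virtual normal form, with the
  one-term virtual combination `[E] − 0` of the bundle of Kleiman's normal form
  (`ChernCharacterBetti.kleimanChernNormalForm_of_presentsAlgebraicClasses`, p782910);
* (HTC) `hTrivialComplements_of_presentsAlgebraicClasses` — h-trivial complements: for `E` finite locally free,
  present the rational algebraic family `κ_p := −ch_p(E)` by a bundle `E'` (`ch_p(E') = −N·ch_p(E) + c_p·hᵖ`,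
  `N ≥ 1`) and put `K := E' ⊕ E^{⊕(N−1)}`; then `ch_p(E) + ch_p(K) = c_p·hᵖ` for every `p`
  (Whitney on the list direct sum, `ChernCharacterBetti.ch_foldr_biprod`);
* `stub_virtualComplements_of_nonempty` — hence the registered stub's statement (both predicates spelled out
  verbatim) follows from `Nonempty ChernCharacterBetti` (item stmt-HodgeConjecture-19780) and Fulton's fact:
  the birth line of 26526 needs nothing beyond the shared construction plus one citation.

[cite: Fulton1998, Example 15.2.16 (b) (PDF p. 283), Example 15.3.2 (PDF p. 286) and Example 3.2.3]
-/

-- every declaration of this problem lives in `Summit.HodgeConjecture.HodgeConjecture.…` (summit = sub-problem)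
set_option linter.dupNamespace false

noncomputable section

open CategoryTheory CategoryTheory.Limits
open scoped ZeroObject

namespace Summit.HodgeConjecture.HodgeConjecture.Theorems.KleimanChernCharacterOnBettiBirth

open Literature.AlgebraicGeometry.Motives Literature.AlgebraicGeometry.HodgeTheory
open Literature.AlgebraicGeometry.KTheory

/-- **(SVNF) for every `C` under Fulton's presentation fact**: Kleiman's normal form
(`kleimanChernNormalForm_of_presentsAlgebraicClasses`) read as the one-term virtual combination `[E] − 0`.
[cite: Fulton1998, Example 15.3.2 (PDF p. 286) and Example 15.2.16 (b) (PDF p. 283)] -/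
theorem sumVirtualNormalForm_of_presentsAlgebraicClasses
    (hF : Fulton1998_chernCharacter_presentsAlgebraicClasses) (C : ChernCharacterBetti) :
    ∀ ⦃n : ℕ⦄ ⦃X : SchemeOver ℂ⦄, IsSmoothProjective n X →
      ∀ (e : ProjectiveEmbedding X) (a : complexBetti (projectiveSpace e.n ℂ) 2),
        IsRationalClass a → a ≠ 0 →
        ∀ ⦃p : ℕ⦄, 0 < p → ∀ ⦃x : complexBetti X (2 * p)⦄, IsRationalClass x →
          x ∈ algebraicClasses X p →
          ∃ (Lp Lm : List X.left.Modules) (q N : ℚ) (c : ℕ → ℚ),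
            (∀ E ∈ Lp, IsFiniteLocallyFree E) ∧ (∀ F ∈ Lm, IsFiniteLocallyFree F) ∧ N ≠ 0 ∧
            (Lp.map fun E => C.ch X E p).sum - (Lm.map fun F => C.ch X F p).sum =
              (q : ℂ) • cupPowTwo (complexBetti.map e.ι 2 a) p + (N : ℂ) • x ∧
            ∀ i : ℕ, 0 < i → i < p →
              (Lp.map fun E => C.ch X E i).sum - (Lm.map fun F => C.ch X F i).sum =
                (c i : ℂ) • cupPowTwo (complexBetti.map e.ι 2 a) i := by
  intro n X hX e a ha ha0 p hp x hx hxalg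
  obtain ⟨E, hE, q, N, c, hN, hchp, hchi⟩ :=
    C.kleimanChernNormalForm_of_presentsAlgebraicClasses hF hX e a ha ha0 hp hx hxalg
  refine ⟨[E], [], q, N, c, fun F hF => ?_, fun F hF => ?_, hN, ?_, fun i hi hip => ?_⟩
  · rw [List.mem_singleton.1 hF]; exact hE
  · simp at hF
  · simpa using hchp
  · simpa using hchi i hi hip

/-- **(HTC) for every `C` under Fulton's presentation fact**: every finite locally free `E` on a smooth projective
`X ⊆ ℙᴺ` has a finite locally free `K` with `chᵢ(E) + chᵢ(K) ∈ ℚ·hⁱ` for all `i ≥ 1`. Present the rational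
algebraic family `κ_p := −ch_p(E)` (`isRationalClass_ch`, `ch_mem_algebraicClasses`) by a bundle `E'` with
`ch_p(E') = N·κ_p + c_p·hᵖ`, `N ≥ 1`, and take `K := E' ⊕ E^{⊕(N−1)}` (Whitney on the direct sum).
[cite: Fulton1998, Example 15.2.16 (b) (PDF p. 283) and Example 3.2.3] -/
theorem hTrivialComplements_of_presentsAlgebraicClasses
    (hF : Fulton1998_chernCharacter_presentsAlgebraicClasses) (C : ChernCharacterBetti) :
    ∀ ⦃n : ℕ⦄ ⦃X : SchemeOver ℂ⦄, IsSmoothProjective n X →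
      ∀ (e : ProjectiveEmbedding X) (a : complexBetti (projectiveSpace e.n ℂ) 2),
        IsRationalClass a → a ≠ 0 →
        ∀ (E : X.left.Modules), IsFiniteLocallyFree E →
          ∃ K : X.left.Modules, IsFiniteLocallyFree K ∧
            ∀ i : ℕ, 0 < i → ∃ r : ℚ, C.ch X E i + C.ch X K i =
              (r : ℂ) • cupPowTwo (complexBetti.map e.ι 2 a) i := by
  intro n X hX e a ha ha0 E hE
  -- the rational algebraic family `κ_p := −ch_p(E)`
  obtain ⟨E', hE', N, c, hN, hch⟩ := hF C hX e a ha ha0 (fun p => (((-1 : ℚ) : ℂ) • C.ch X E p))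
    (fun p => (C.isRationalClass_ch X E hE.isVectorBundle p).smul (-1))
    (fun p => Submodule.smul_mem _ _ (C.ch_mem_algebraicClasses hX E hE.isVectorBundle p))
  obtain ⟨k, rfl⟩ : ∃ k : ℕ, N = k + 1 := ⟨N - 1, by omega⟩
  -- `K := E' ⊕ E^{⊕ k} ⊕ 0`
  set L : List X.left.Modules := E' :: List.replicate k E with hL
  have hLf : ∀ F ∈ L, IsFiniteLocallyFree F := by
    intro F hF
    rcases List.mem_cons.1 hF with rfl | hF
    · exact hE'
    · rw [List.eq_of_mem_replicate hF]; exact hE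
  have hZ : IsFiniteLocallyFree (0 : X.left.Modules) := KZero.isFiniteLocallyFree_of_isZero (isZero_zero _)
  refine ⟨L.foldr (· ⊞ ·) 0, isFiniteLocallyFree_foldr_biprod hZ L hLf, fun i _ => ⟨c i, ?_⟩⟩
  rw [C.ch_foldr_biprod hZ i L hLf, C.ch_eq_zero_of_isZero (isZero_zero _), add_zero, hL, List.map_cons,
    List.sum_cons, List.map_replicate, List.sum_replicate, hch i, ← Nat.cast_smul_eq_nsmul ℂ, smul_smul]
  push_cast
  module

/-- **The registered stub `stub_virtualComplements` modulo the shared construction item and Fulton's fact**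
(both predicates `SumVirtualNormalForm`, `HTrivialComplements` of `Cruxes/KleimanChernCharacterOnBetti/Lines/birth.lean`
spelled out verbatim): `Nonempty ChernCharacterBetti` (stmt-HodgeConjecture-19780) and
`Fulton1998_chernCharacter_presentsAlgebraicClasses` give a `C` with (SVNF) ∧ (HTC) — indeed EVERY `C` has both.
[cite: Fulton1998, Example 15.2.16 (b) (PDF p. 283), Example 15.3.2 (PDF p. 286) and Example 3.2.3] -/
theorem stub_virtualComplements_of_nonempty (hCC : Nonempty ChernCharacterBetti)
    (hF : Fulton1998_chernCharacter_presentsAlgebraicClasses) :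
    ∃ C : ChernCharacterBetti,
      (∀ ⦃n : ℕ⦄ ⦃X : SchemeOver ℂ⦄, IsSmoothProjective n X →
        ∀ (e : ProjectiveEmbedding X) (a : complexBetti (projectiveSpace e.n ℂ) 2),
          IsRationalClass a → a ≠ 0 →
          ∀ ⦃p : ℕ⦄, 0 < p → ∀ ⦃x : complexBetti X (2 * p)⦄, IsRationalClass x →
            x ∈ algebraicClasses X p →
            ∃ (Lp Lm : List X.left.Modules) (q N : ℚ) (c : ℕ → ℚ),
              (∀ E ∈ Lp, IsFiniteLocallyFree E) ∧ (∀ F ∈ Lm, IsFiniteLocallyFree F) ∧ N ≠ 0 ∧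
              (Lp.map fun E => C.ch X E p).sum - (Lm.map fun F => C.ch X F p).sum =
                (q : ℂ) • cupPowTwo (complexBetti.map e.ι 2 a) p + (N : ℂ) • x ∧
              ∀ i : ℕ, 0 < i → i < p →
                (Lp.map fun E => C.ch X E i).sum - (Lm.map fun F => C.ch X F i).sum =
                  (c i : ℂ) • cupPowTwo (complexBetti.map e.ι 2 a) i) ∧
      (∀ ⦃n : ℕ⦄ ⦃X : SchemeOver ℂ⦄, IsSmoothProjective n X →
        ∀ (e : ProjectiveEmbedding X) (a : complexBetti (projectiveSpace e.n ℂ) 2),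
          IsRationalClass a → a ≠ 0 →
          ∀ (E : X.left.Modules), IsFiniteLocallyFree E →
            ∃ K : X.left.Modules, IsFiniteLocallyFree K ∧
              ∀ i : ℕ, 0 < i → ∃ r : ℚ, C.ch X E i + C.ch X K i =
                (r : ℂ) • cupPowTwo (complexBetti.map e.ι 2 a) i) := by
  obtain ⟨C⟩ := hCC
  exact ⟨C, sumVirtualNormalForm_of_presentsAlgebraicClasses hF C,
    hTrivialComplements_of_presentsAlgebraicClasses hF C⟩

end Summit.HodgeConjecture.HodgeConjecture.Theorems.KleimanChernCharacterOnBettiBirth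

end
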